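import Summits.ResolutionOfSingularities.ResolutionOfSingularities.Theorems.UniversalCellsCampaignW82SmoothTwistGradedProofs
import HarnessLib

/-!
# [OURS · L1 W8.2] The smooth-twist step: rungs (dimension ≤ 1 over any field, ≤ 3 given F-02) and the
# graded kernel from it — proofs

Cell `res-hironaka`, LADDER-RESOLUTION rung L (RESCUE), slot W8.2, host route `UniversalCells`, host item
`PrimeFieldToPerfect` (stmt-ResolutionOfSingularities-15233); prover res-L1-s82-pv-1 (gen 2). THESES-FREE sequel of
Theorems/UniversalCellsCampaignW82SmoothTwistGradedProofs.lean (names from the statement file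
Theorems/UniversalCellsCampaignW82SmoothTwistGraded.lean, p481193).

WHAT IS PROVED:
* `hasSmoothModelAtFiniteLevel_of_dim_le_one` — over ANY field `K`, every separated `X₀` of finite type and
  dimension `≤ 1` which is integral over the perfect closure acquires, after a FINITE purely inseparable
  extension `K'/K`, a proper birational model SMOOTH over `K'` — UNCONDITIONAL (curves are resolved over every
  field, `hasResolution_of_dim_le_one`, applied over the perfect closure; then the descent theorem
  `hasSmoothModelAtFiniteLevel_of_hasResolution`). The classical «a curve becomes smooth after a finite purely
  inseparable extension of the constants», in the tree's idiom.
* `hasSmoothModelAtFiniteLevel_of_dim_le_three` — the same in dimension `≤ 3`, CONDITIONAL on the named fact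
  F-02 `CossartPiltant2019` (hypothesis `hCP`).
* `smoothTwistStepAt_of_le_one` / `smoothTwistStepAt_of_le_three`, `smoothTwistStepDimLe_of_le_one` /
  `smoothTwistStepDimLe_of_le_three` — the rungs `n ≤ 1` (unconditional) / `n ≤ 3` (F-02) of the smooth-twist
  step at every field / of the door-1 graded name; so `n = 4` is its first open rung, as for the perfection step.
* `climbRatFuncPerfDimLe_of_spreadOut_of_smoothTwistStep`, `climbRatFuncPerfDimLe_succ_of_smoothTwistStep`
  (kernel grade `(n + 1, n)` — e.g. the headline `(5, 4)` — from grade `n` of the smooth-twist step ALONE, the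
  finite-level transfer `familyTransferSucc_holds` being a theorem), `climbRatFuncPerfDimLe_top_top_of_smoothTwistStep_top`
  (the registered kernel of stmt-15233 / stmt-8933 from the smooth-twist step at `⊤`),
  `perfectionStepAlgClosureFgDimLe_of_forall_smoothTwistStepAt` (door 2's sharpest residual by name).

HONEST FRAMING. OURS work of the rescue rung (role replaced: §17 ¶2 p.89 l.59–62 / §2 p.4 l.22–24 of
[Hironaka2017], see the statement file); NOT a statement of the manuscript; the only external premise is
FACT-LIST F-02, as an explicit hypothesis of the `…_le_three` rungs. AI work, weaker than expert review.

## References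
* V. Cossart, O. Piltant, J. Algebra 529 (2019), Thm. 1.1 — named fact F-02. [CossartPiltant2019]
* The Stacks Project, Tag 0BWJ area (smooth models of curves after purely inseparable extension) — context for
  the dimension-one rung, not used. [StacksProject]
-/

noncomputable section

set_option linter.dupNamespace false -- mandated namespace of this single-conjunct summit

open _root_.CategoryTheory _root_.CategoryTheory.Limits _root_.AlgebraicGeometry
open Literature.AlgebraicGeometry.Resolution

namespace Summit.ResolutionOfSingularities.ResolutionOfSingularities.Theorems.CampaignW82

/-! ## Rungs: smooth models at a finite level exist unconditionally in dimension ≤ 1, and in dimension ≤ 3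
given the named fact F-02 -/

/-- **Smooth models of CURVES at a finite purely inseparable level, over ANY field** (unconditional): for a
separated `f₀ : X₀ ⟶ Spec K` of finite type with `topologicalKrullDim X₀ ≤ 1` which is integral over the perfect
closure, some finite purely inseparable `K'/K` carries a proper birational model of `X₀ ×_K K'` smooth over
`K'`. Proof: resolve the curve `X₀ ×_K L` over the perfect closure (curves are resolved over every field,
`hasResolution_of_dim_le_one`; dimension by `topologicalKrullDim_eq_of_isPullback`) and descend
(`hasSmoothModelAtFiniteLevel_of_hasResolution`). This is the classical «a curve becomes smooth after a finite
purely inseparable extension of the ground field» in the tree's idiom. [folklore] -/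
theorem hasSmoothModelAtFiniteLevel_of_dim_le_one (K : Type) [Field K] {X₀ : Scheme.{0}}
    (f₀ : X₀ ⟶ Spec (.of K)) [IsSeparated f₀] [LocallyOfFiniteType f₀] [QuasiCompact f₀]
    (hd : topologicalKrullDim X₀ ≤ 1) (hint : IntegralOverPerfectClosure K f₀) :
    HasSmoothModelAtFiniteLevel K f₀ := by
  obtain ⟨L, _, _, _, _, hXL⟩ := hint
  haveI := hXL
  have hdimL : topologicalKrullDim
      ↥(pullback f₀ (Spec.map (CommRingCat.ofHom (algebraMap K L)))) ≤ 1 := by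
    rw [Literature.AlgebraicGeometry.Motives.topologicalKrullDim_eq_of_isPullback (algebraMap K L) f₀
      (pullback.fst f₀ (Spec.map (CommRingCat.ofHom (algebraMap K L)))) (pullback.snd _ _)
      (IsPullback.of_hasPullback f₀ (Spec.map (CommRingCat.ofHom (algebraMap K L))))]
    exact hd
  exact hasSmoothModelAtFiniteLevel_of_hasResolution K f₀ L
    (hasResolution_of_dim_le_one _ (pullback.snd f₀ (Spec.map (CommRingCat.ofHom (algebraMap K L)))) hdimL)

/-- **Smooth models at a finite purely inseparable level in dimension `≤ 3`, over ANY field, CONDITIONAL on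
the named fact F-02 `CossartPiltant2019`** (taken as the hypothesis `hCP`): Cossart–Piltant resolve the
threefold `X₀ ×_K L` over the perfect closure `L`, and the resolution descends
(`hasSmoothModelAtFiniteLevel_of_hasResolution`). [cite: CossartPiltant2019, Thm. 1.1] -/
theorem hasSmoothModelAtFiniteLevel_of_dim_le_three (hCP : CossartPiltant2019.{0}) (K : Type) [Field K]
    {X₀ : Scheme.{0}} (f₀ : X₀ ⟶ Spec (.of K)) [IsSeparated f₀] [LocallyOfFiniteType f₀] [QuasiCompact f₀]
    (hd : topologicalKrullDim X₀ ≤ 3) (hint : IntegralOverPerfectClosure K f₀) :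
    HasSmoothModelAtFiniteLevel K f₀ := by
  obtain ⟨L, _, _, _, _, hXL⟩ := hint
  haveI := hXL
  have hdimL : topologicalKrullDim
      ↥(pullback f₀ (Spec.map (CommRingCat.ofHom (algebraMap K L)))) ≤ 3 := by
    rw [Literature.AlgebraicGeometry.Motives.topologicalKrullDim_eq_of_isPullback (algebraMap K L) f₀
      (pullback.fst f₀ (Spec.map (CommRingCat.ofHom (algebraMap K L)))) (pullback.snd _ _)
      (IsPullback.of_hasPullback f₀ (Spec.map (CommRingCat.ofHom (algebraMap K L))))]
    exact hd
  exact hasSmoothModelAtFiniteLevel_of_hasResolution K f₀ L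
    (hCP L _ (pullback.snd f₀ (Spec.map (CommRingCat.ofHom (algebraMap K L)))) inferInstance
      inferInstance inferInstance inferInstance hdimL)

/-- The smooth-twist step at every field `M`, rung `n ≤ 1`, UNCONDITIONAL (hypothesis over `RatFunc M`
unused). [folklore] -/
theorem smoothTwistStepAt_of_le_one (M : Type) [Field M] {n : WithBot ℕ∞} (hn : n ≤ 1) :
    SmoothTwistStepAt M n := by
  intro _ K _ _ _ _ X₀ f₀ hs hl hq hd hint
  haveI := hs
  haveI := hl
  haveI := hq
  exact hasSmoothModelAtFiniteLevel_of_dim_le_one K f₀ (hd.trans hn) hint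

/-- The smooth-twist step at every field `M`, rung `n ≤ 3`, CONDITIONAL on F-02 (`hCP`; hypothesis over
`RatFunc M` unused). So grade `n = 4` is the first open rung, in smooth-twist form as in perfection form.
[cite: CossartPiltant2019, Thm. 1.1] -/
theorem smoothTwistStepAt_of_le_three (hCP : CossartPiltant2019.{0}) (M : Type) [Field M]
    {n : WithBot ℕ∞} (hn : n ≤ 3) : SmoothTwistStepAt M n := by
  intro _ K _ _ _ _ X₀ f₀ hs hl hq hd hint
  haveI := hs
  haveI := hl
  haveI := hq
  exact hasSmoothModelAtFiniteLevel_of_dim_le_three hCP K f₀ (hd.trans hn) hint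

/-- Door 1 graded name, rung `n ≤ 1`, unconditional. [folklore] -/
theorem smoothTwistStepDimLe_of_le_one (p : ℕ) {n : WithBot ℕ∞} (hn : n ≤ 1) :
    SmoothTwistStepDimLe p n :=
  fun M _ _ _ => smoothTwistStepAt_of_le_one M hn

/-- Door 1 graded name, rung `n ≤ 3`, conditional on F-02. [cite: CossartPiltant2019, Thm. 1.1] -/
theorem smoothTwistStepDimLe_of_le_three (hCP : CossartPiltant2019.{0}) (p : ℕ) {n : WithBot ℕ∞}
    (hn : n ≤ 3) : SmoothTwistStepDimLe p n :=
  fun M _ _ _ => smoothTwistStepAt_of_le_three hCP M hn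

/-! ## The graded kernel from the smooth-twist step -/

/-- **Kernel grade `(m, n)` from the finite-level transfer and the smooth-twist step** (door 1):
`SpreadOutRatFuncDimLe p m n → SmoothTwistStepDimLe p n → ClimbRatFuncPerfDimLe p m n`. [folklore] -/
theorem climbRatFuncPerfDimLe_of_spreadOut_of_smoothTwistStep {p : ℕ} {m n : WithBot ℕ∞}
    (h₁ : SpreadOutRatFuncDimLe p m n) (h₂ : SmoothTwistStepDimLe p n) : ClimbRatFuncPerfDimLe p m n :=
  climbRatFuncPerfDimLe_of_spreadOut_of_perfectionStep h₁ (perfectionStepDimLe_of_smoothTwistStepDimLe h₂)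

/-- **Kernel grade `(n + 1, n)` from the smooth-twist step at grade `n` alone** (door 1; the finite-level
transfer `familyTransferSucc_holds` is a theorem): in particular the first open kernel rung `(5, 4)` is the
statement «every irreducible geometrically reduced fourfold over a finite level `M(t^{1/p^e})`, `M` perfect
with resolution of fivefolds… — no: with resolution over `RatFunc M` in dimension `≤ 4` —, acquires a smooth
proper birational model after finitely many more `p`-th roots of `t`». [folklore] -/
theorem climbRatFuncPerfDimLe_succ_of_smoothTwistStep {p : ℕ} {n : WithBot ℕ∞}
    (h : SmoothTwistStepDimLe p n) : ClimbRatFuncPerfDimLe p (n + 1) n :=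
  climbRatFuncPerfDimLe_succ_of_perfectionStep (perfectionStepDimLe_of_smoothTwistStepDimLe h)

/-- **The whole kernel from the smooth-twist step at the top grade** (door 1):
`SmoothTwistStepDimLe p ⊤ → ClimbRatFuncPerfDimLe p ⊤ ⊤` (= the registered kernel `ClimbRatFuncPerf p` of
stmt-15233 / stmt-8933 by `climbRatFuncPerfDimLe_top_iff`). [folklore] -/
theorem climbRatFuncPerfDimLe_top_top_of_smoothTwistStep_top {p : ℕ} (h : SmoothTwistStepDimLe p ⊤) :
    ClimbRatFuncPerfDimLe p ⊤ ⊤ :=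
  climbRatFuncPerfDimLe_top_top_of_perfectionStep_top (perfectionStepDimLe_of_smoothTwistStepDimLe h)

/-- **Door 2's sharpest kernel grade `(n + 1, n)` from the smooth-twist step at the countable constant
fields** (via pv-2's `climbRatFuncPerfAlgClosureFgDimLe_succ_of_perfectionStepAlgClosureFg`-type reduction:
here through the perfection step). [folklore] -/
theorem perfectionStepAlgClosureFgDimLe_of_forall_smoothTwistStepAt {p : ℕ} {n : WithBot ℕ∞}
    (h : ∀ (K : Type) [Field K] [CharP K p] [IsAlgClosed K] (s : Finset K),
      SmoothTwistStepAt (algebraicClosure (Subfield.closure (↑s : Set K)) K) n) :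
    PerfectionStepAlgClosureFgDimLe p n :=
  (perfectionStepAlgClosureFgDimLe_iff_forall_smoothTwistStepAt p n).2 h

end Summit.ResolutionOfSingularities.ResolutionOfSingularities.Theorems.CampaignW82

end
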